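import Literature.ComputerArithmetic.Lefevre2005.SegmentGrid
import HarnessLib

/-!
# The division-based ("regular") lower-bound test of Fortin–Gouicem–Graillat for Lefèvre's HR-case search

P. Fortin, M. Gouicem, S. Graillat, *GPU-Accelerated Generation of Correctly Rounded Elementary Functions*,
ACM Trans. Math. Software 43(3), Article 22 (2016), doi:10.1145/2935746 (= arXiv:1211.3056v2, HAL
hal-00751446) [FortinGouicemGraillat2016] — §3.2 "Properties of the set `{a·x mod 1 | x < n}`" and §4.2
"New regular HR-case search" (Algorithm 2 of the arXiv version, "New regular lower bound computation and
test algorithm"; Algorithm 1 there is Lefèvre's lower-bound test written with divisions).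

The setting is the one of `Literature.ComputerArithmetic.Lefevre2005.SegmentGrid` ([Lefevre2005]): a segment
`y = b - a·x`, `0 ≤ x < N`, and the question whether some `k < N` has `{b - k·a}` below a threshold
(`{·} = Int.fract`). Lefèvre's Algorithm 1 answers it exactly with SUBTRACTIVE steps on the two interval
lengths; its cost is the sum of the partial quotients of the continued fraction of `{a}` met before `N`
points are placed, which is large when the slope is close to a rational with a small denominator
([Lefevre2005, §3–§4]: "in Algorithm 2, divisions are not performed when the value of d (or r) would be
modified, making it similar to subtractive algorithms"). Fortin–Gouicem–Graillat replace every run of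
subtractions by ONE division, including the updates of the distance `d` (a `mod`), visiting only the
"division" two-length configurations `(i, 0)` of the three-distance theorem.

## What is here (any linearly ordered field `K` with a floor function; `ℚ` computes)

* §3.2, Property 1 (two-length configurations construction, after Slater 1967) and Property 2 (directed
  reduction, after van Ravenstein 1988), phrased on Lefèvre's configurations
  `Lefevre2005.IsConfig a u v x y` and PROVED by iterating the one-step transitions of that file:
  `splitY_iter` — while `t·x < y`, `t` consecutive steps turn `(u, v, x, y)` into `(u + t·v, v, x, y - t·x)`,
  every interval of length `y` being cut FROM THE LEFT into `t` pieces of length `x` and a remainder;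
  `splitX_iter` — while `t·y < x`, `(u, v, x, y) ↦ (u, v + t·u, x - t·y, y)`, every interval of length `x`
  being cut FROM THE RIGHT. Where a fixed point `b` sits is tracked by `Sits a b u v x y k₀ D` ("`b` lies in
  the interval whose lower boundary is the point of index `k₀`, at distance `D` from it") and the lemmas
  `sits_splitY_iter_*` / `sits_splitX_iter_*` give the new position in closed form — a `mod` by the short
  length, exactly the updates `d = d mod p` and `d = (d - p) mod q` of the regular algorithm.
* §4.2, the algorithm, transcribed as `regularTest a b ε N : Bool` (`true` = "Success"):
  ```
  input: b - a·x, ε'', N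
  initialisation: p ← {a}; q ← 1; d ← {b}; u ← 1; v ← 0;
  if d < ε'' then return Failure
  while True do
    if p < q then
      k = ⌊q/p⌋;  q = q - k*p; u = u + k*v;  d = d mod p
    else
      k = ⌊p/q⌋;  p = p - k*q; v = v + k*u;  if d ≥ p then d = (d - p) mod q
    if u + v ≥ N then return (d > ε'')
  ```
  with `x mod y := x - ⌊x/y⌋·y` (`fmod`). ONE DEVIATION, marked in the code: when a length becomes `0`
  (the continued fraction of a rational `{a}` terminates — "the properties … are also valid for a rational
  as long as θᵢ ≠ 0" [FortinGouicemGraillat2016, §3.2]; cf. the tests `x = 0`, `y = 0` of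
  [Lefevre2005, Algorithm 2]) we return Failure instead of dividing by zero. The loop carries an iteration
  bound (fuel) as in `Lefevre2005.algorithm1`; running out of fuel also answers Failure.
* **THEOREM `regularTest_sound`**: if `regularTest a b ε N = true` then `ε < {b - k·a}` for every `k < N`
  — the test is a correct FILTER ("computes a lower bound on `{b - a·x mod 1 | x < N}`",
  [FortinGouicemGraillat2016, §4.2]). Consequently (`le_algorithm1_of_regularTest`) a successful run gives
  the hypothesis `N ≤ Lefevre2005.algorithm1 a b ε N` of the sub-domain certificates of
  `Literature.ComputerArithmetic.Lefevre2005.SubdomainCertificate` WITHOUT evaluating Algorithm 1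
  (informally: the loop runs once per partial quotient of `{a}` consumed, whatever its size — "only
  O(log n) such configurations" [FortinGouicemGraillat2016, §3.2]; no cost statement is formalised).

## Remarks recorded, not hidden
* The printed initialisation `u ← 1; v ← 0` does not match the printed semantics "u and v store
  respectively qᵢ and qᵢ₋₁" (with it, `u + v` after the first iteration is `1` although `k₁ + 1` points have
  been placed; the update statements themselves follow Lefèvre's convention `u` = number of intervals of
  length `p`). We transcribe the listing AS PRINTED; the invariant below only uses `u ≤ U`, `v ≤ V` for the
  true numbers `U`, `V` of intervals, which is what makes the printed version sound (it may examine one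
  configuration more than necessary). `rloop_sound` is stated for an arbitrary state satisfying the
  invariant, so other initialisations are covered as well.
* The test inspects the first division configuration `(i, 0)` holding at least `N` points (respectively one
  more, see above). That configuration can hold MANY more than `N` points when the next partial quotient is
  large, and the answer is then a lower bound over all of them: Success is always right (the theorem), Failure
  may be spurious where Lefèvre's Algorithm 1 (at most `2N` points, [FortinGouicemGraillat2016, §4.1]) succeeds.
* Not transcribed: the GPU deployment (§4.3), the `swap` and unrolled variants (Algorithms 3–4 of the arXiv
  version), the polynomial-approximation pipeline (§5), and any cost statement.
-/

namespace Literature.ComputerArithmetic.FortinGouicemGraillat2016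

open Literature.ComputerArithmetic.Lefevre2005

variable {K : Type*} [Field K] [LinearOrder K] [IsStrictOrderedRing K] [FloorRing K]

/-! ### `x mod y` on lengths -/

/-- `fmod d p = d - ⌊d/p⌋·p`, the `mod` of the listing ("d = d mod p") on non-negative lengths.
[cite: FortinGouicemGraillat2016, §4.2 Algorithm 2] -/
def fmod (d p : K) : K := d - (⌊d / p⌋₊ : K) * p

omit [IsStrictOrderedRing K] in
/-- Unfolding `fmod`. [cite: FortinGouicemGraillat2016, §4.2] -/
theorem fmod_def (d p : K) : fmod d p = d - (⌊d / p⌋₊ : K) * p := rfl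

/-- `0 ≤ d mod p` for `0 ≤ d`, `0 < p`. [cite: FortinGouicemGraillat2016, §4.2] -/
theorem fmod_nonneg {d p : K} (hd : 0 ≤ d) (hp : 0 < p) : 0 ≤ fmod d p := by
  have h := Nat.floor_le (div_nonneg hd hp.le)
  rw [fmod_def, sub_nonneg]
  calc (⌊d / p⌋₊ : K) * p ≤ d / p * p := by gcongr
    _ = d := div_mul_cancel₀ d hp.ne'

/-- `d mod p < p` for `0 < p`. [cite: FortinGouicemGraillat2016, §4.2] -/
theorem fmod_lt {d p : K} (hp : 0 < p) : fmod d p < p := by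
  have h := Nat.lt_floor_add_one (d / p)
  have h' : d < ((⌊d / p⌋₊ : K) + 1) * p := by
    calc d = d / p * p := (div_mul_cancel₀ d hp.ne').symm
      _ < ((⌊d / p⌋₊ : K) + 1) * p := by gcongr
  rw [fmod_def]; linarith

/-- Uniqueness of the remainder: `(e + n·p) mod p = e` when `0 ≤ e < p`.
[cite: FortinGouicemGraillat2016, §4.2] -/
theorem fmod_add_nat_mul {e p : K} (he : 0 ≤ e) (hep : e < p) (n : ℕ) : fmod (e + n * p) p = e := by
  have hp : 0 < p := lt_of_le_of_lt he hep
  have hfl : ⌊(e + n * p) / p⌋₊ = n := by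
    rw [show (e + n * p) / p = e / p + n by field_simp, Nat.floor_add_natCast (div_nonneg he hp.le),
      Nat.floor_eq_zero.2 ((div_lt_one hp).2 hep), zero_add]
  rw [fmod_def, hfl]; ring

/-- `d mod p = d` when `0 ≤ d < p`. [cite: FortinGouicemGraillat2016, §4.2] -/
theorem fmod_eq_self {d p : K} (hd : 0 ≤ d) (hdp : d < p) : fmod d p = d := by
  simpa using fmod_add_nat_mul hd hdp 0

/-- `(d + p) mod p = d mod p` for `0 ≤ d`, `0 < p`. [cite: FortinGouicemGraillat2016, §4.2] -/
theorem fmod_add_self {d p : K} (hd : 0 ≤ d) (hp : 0 < p) : fmod (d + p) p = fmod d p := by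
  have e1 : d + p = fmod d p + (⌊d / p⌋₊ + 1 : ℕ) * p := by rw [fmod_def]; push_cast; ring
  rw [e1, fmod_add_nat_mul (fmod_nonneg hd hp) (fmod_lt hp)]

/-- `(d - p) mod p = d mod p` for `p ≤ d`, `0 < p`. [cite: FortinGouicemGraillat2016, §4.2] -/
theorem fmod_sub_self {d p : K} (hpd : p ≤ d) (hp : 0 < p) : fmod (d - p) p = fmod d p := by
  have h := fmod_add_self (sub_nonneg.2 hpd) hp
  rw [sub_add_cancel] at h
  exact h.symm

/-- `d mod p ≤ d` for `0 < p`. [cite: FortinGouicemGraillat2016, §4.2] -/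
theorem fmod_le_self (d : K) {p : K} (hp : 0 < p) : fmod d p ≤ d := by
  have h : 0 ≤ (⌊d / p⌋₊ : K) * p := mul_nonneg (Nat.cast_nonneg _) hp.le
  rw [fmod_def]; linarith

/-! ### Where `b` sits in a configuration -/

/-- In the configuration `IsConfig a u v x y` (points `{k·a}`, `k < u + v`), `b` lies in the interval whose
lower boundary is the point of index `k₀`, at distance `D` from it: `{b - k₀·a} = D < ℓ(k₀)` where
`ℓ(k₀) = x` if `k₀ < u` and `y` otherwise (intervals are closed on the left, [Lefevre2005, §2.3 fn. 2]).
Then `D` is the distance from `b` to the closest point to its left, the quantity `d` of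
[FortinGouicemGraillat2016, §4.1–4.2]. [cite: FortinGouicemGraillat2016, §4.1] -/
structure Sits (a b : K) (u v : ℕ) (x y : K) (k₀ : ℕ) (D : K) : Prop where
  lt : k₀ < u + v
  dist : Int.fract (b - k₀ * a) = D
  lt_len : D < if k₀ < u then x else y

namespace Sits

variable {a b x y D : K} {u v k₀ : ℕ}

/-- `0 ≤ D`. [cite: FortinGouicemGraillat2016, §4.1] -/
theorem nonneg (hs : Sits a b u v x y k₀ D) : 0 ≤ D := hs.dist ▸ Int.fract_nonneg _

/-- `D` is a lower bound on all the distances `{b - k·a}`, `k < u + v` (it is their minimum, attained at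
`k₀`). [cite: FortinGouicemGraillat2016, §4.1] -/
theorem le_fract (hc : IsConfig a u v x y) (hs : Sits a b u v x y k₀ D) {k : ℕ} (hk : k < u + v) :
    D ≤ Int.fract (b - k * a) := by
  by_cases hne : k = k₀
  · rw [hne, hs.dist]
  · have h := hc.len_add_le_dist hs.lt hs.dist hs.lt_len hk hne
    have hpos : 0 < (if k < u then x else y) := by split_ifs; exacts [hc.x_pos, hc.y_pos]
    linarith

omit [IsStrictOrderedRing K] in
/-- One step `h = y` (`x < y`) seen from `b` when `b` is within `x` of the point to its left (always the
case in an interval of length `x`; the left part of an interval of length `y`): the same point stays the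
closest one, and it is now the lower boundary of an interval of length `x`.
[cite: FortinGouicemGraillat2016, §3.2 Property 2] -/
theorem splitY_keep (hs : Sits a b u v x y k₀ D) (hDx : D < x) : Sits a b (u + v) v x (y - x) k₀ D where
  lt := by have := hs.lt; omega
  dist := hs.dist
  lt_len := by rw [if_pos hs.lt]; exact hDx

/-- One step `h = y` (`x < y`), `b` in the interval of length `y` with lower boundary `u + j`, in its right
part (`x ≤ D`): `b` now lies in the new interval of length `y - x` whose lower boundary is the new point
`u + v + j`, at distance `D - x`. [cite: FortinGouicemGraillat2016, §3.2 Property 2] -/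
theorem splitY_move (hc : IsConfig a u v x y) {j : ℕ} (hs : Sits a b u v x y (u + j) D)
    (hxD : x ≤ D) : Sits a b (u + v) v x (y - x) (u + v + j) (D - x) where
  lt := by have := hs.lt; omega
  dist := by
    have h := hc.dist_splitY_self (j := j) hs.dist
    rw [if_pos hxD] at h
    exact_mod_cast h
  lt_len := by
    have h := hs.lt_len
    rw [if_neg (by omega)] at h
    rw [if_neg (by omega)]
    linarith

omit [IsStrictOrderedRing K] in
/-- One step `h = x` (`y < x`), `b` in an interval of length `y`: nothing changes for `b`.
[cite: FortinGouicemGraillat2016, §3.2 Property 2] -/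
theorem splitX_of_ge (hs : Sits a b u v x y k₀ D) (hk : u ≤ k₀) : Sits a b u (v + u) (x - y) y k₀ D where
  lt := by have := hs.lt; omega
  dist := hs.dist
  lt_len := by
    have h := hs.lt_len
    rw [if_neg (not_lt.2 hk)] at h
    rwa [if_neg (not_lt.2 hk)]

omit [IsStrictOrderedRing K] in
/-- One step `h = x` (`y < x`), `b` in the interval of length `x` with lower boundary `k₀ < u`, in its left
part (`D < x - y`): same lower boundary, the interval now has length `x - y`.
[cite: FortinGouicemGraillat2016, §3.2 Property 2] -/
theorem splitX_keep (hs : Sits a b u v x y k₀ D) (hk : k₀ < u) (hD : D < x - y) :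
    Sits a b u (v + u) (x - y) y k₀ D where
  lt := by have := hs.lt; omega
  dist := hs.dist
  lt_len := by rwa [if_pos hk]

/-- One step `h = x` (`y < x`), `b` in the interval of length `x` with lower boundary `k₀ < u`, in its right
part (`x - y ≤ D`): `b` now lies in the new interval of length `y` whose lower boundary is the new point
`u + v + k₀`, at distance `D - (x - y)`. [cite: FortinGouicemGraillat2016, §3.2 Property 2] -/
theorem splitX_move (hc : IsConfig a u v x y) (hyx : y < x) (hs : Sits a b u v x y k₀ D)
    (hk : k₀ < u) (hD : x - y ≤ D) : Sits a b u (v + u) (x - y) y (u + v + k₀) (D - (x - y)) where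
  lt := by omega
  dist := by
    have h := hc.dist_splitX_self hyx (k₀ := k₀) hs.dist
    rwa [if_pos hD] at h
  lt_len := by
    have h := hs.lt_len
    rw [if_pos hk] at h
    rw [if_neg (by omega)]
    linarith

end Sits

/-! ### §3.2 Properties 1–2: `t` consecutive steps at once (one division) -/

section Iter

variable {a b x y D : K} {u v k₀ : ℕ}

/-- **Property 1, `h = y` side, iterated** (configurations `(i, t)`, `t = 0, 1, …`): while `t·x < y`,
`t` steps turn `(u, v, x, y)` into `(u + t·v, v, x, y - t·x)`.
[cite: FortinGouicemGraillat2016, §3.2 Property 1] -/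
theorem splitY_iter (hc : IsConfig a u v x y) :
    ∀ t : ℕ, (t : K) * x < y → IsConfig a (u + t * v) v x (y - t * x)
  | 0, _ => by simpa using hc
  | t + 1, ht => by
    have hx := hc.x_pos
    have ht' : (t : K) * x < y := by push_cast at ht; linarith
    have h := (splitY_iter hc t ht').splitY (by push_cast at ht; linarith)
    have e1 : u + (t + 1) * v = u + t * v + v := by ring
    have e2 : y - ((t + 1 : ℕ) : K) * x = y - (t : K) * x - x := by push_cast; ring
    rw [e1, e2]; exact h

/-- **Property 1, `h = x` side, iterated**: while `t·y < x`, `t` steps turn `(u, v, x, y)` into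
`(u, v + t·u, x - t·y, y)`. [cite: FortinGouicemGraillat2016, §3.2 Property 1] -/
theorem splitX_iter (hc : IsConfig a u v x y) :
    ∀ t : ℕ, (t : K) * y < x → IsConfig a u (v + t * u) (x - t * y) y
  | 0, _ => by simpa using hc
  | t + 1, ht => by
    have hy := hc.y_pos
    have ht' : (t : K) * y < x := by push_cast at ht; linarith
    have h := (splitX_iter hc t ht').splitX (by push_cast at ht; linarith)
    have e1 : v + (t + 1) * u = v + t * u + u := by ring
    have e2 : x - ((t + 1 : ℕ) : K) * y = x - (t : K) * y - y := by push_cast; ring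
    rw [e1, e2]; exact h

/-- **Property 2 (directed reduction), `h = y` side**: `b` in an interval of length `x` is not affected by
the `t` steps. [cite: FortinGouicemGraillat2016, §3.2 Property 2] -/
theorem sits_splitY_iter_of_lt (hc : IsConfig a u v x y) (hs : Sits a b u v x y k₀ D) (hk : k₀ < u) :
    ∀ t : ℕ, (t : K) * x < y → Sits a b (u + t * v) v x (y - t * x) k₀ D
  | 0, _ => by simpa using hs
  | t + 1, ht => by
    have hx := hc.x_pos
    have hDx : D < x := by have h := hs.lt_len; rwa [if_pos hk] at h
    have ht' : (t : K) * x < y := by push_cast at ht; linarith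
    have h := (sits_splitY_iter_of_lt hc hs hk t ht').splitY_keep hDx
    have e1 : u + (t + 1) * v = u + t * v + v := by ring
    have e2 : y - ((t + 1 : ℕ) : K) * x = y - (t : K) * x - x := by push_cast; ring
    rw [e1, e2]; exact h

/-- **Property 2 (directed reduction), `h = y` side**: the intervals of length `y` are cut FROM THE LEFT
into pieces of length `x`. If `b` lies in the one with lower boundary `u + j`, at distance `D`, then after
`t` steps (`t·x < y`): when `t·x ≤ D`, `b` lies in the remaining interval of length `y - t·x` (lower
boundary the newest point `u + t·v + j`) at distance `D - t·x`; when `D < t·x`, `b` lies in the piece of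
length `x` with lower boundary `u + m·v + j`, `m = ⌊D/x⌋`, at distance `D - m·x = D mod x`.
[cite: FortinGouicemGraillat2016, §3.2 Property 2, §4.2] -/
theorem sits_splitY_iter_of_ge (hc : IsConfig a u v x y) {j : ℕ} (hs : Sits a b u v x y (u + j) D) :
    ∀ t : ℕ, (t : K) * x < y →
      ((t : K) * x ≤ D → Sits a b (u + t * v) v x (y - t * x) (u + t * v + j) (D - t * x)) ∧
      (D < (t : K) * x →
        Sits a b (u + t * v) v x (y - t * x) (u + ⌊D / x⌋₊ * v + j) (D - (⌊D / x⌋₊ : K) * x))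
  | 0, _ => by
    refine ⟨fun _ => by simpa using hs, fun h => ?_⟩
    exact absurd h (by simpa using hs.nonneg)
  | t + 1, ht => by
    have hx := hc.x_pos
    have hD0 := hs.nonneg
    have ht' : (t : K) * x < y := by push_cast at ht; linarith
    have hct := splitY_iter hc t ht'
    obtain ⟨IH1, IH2⟩ := sits_splitY_iter_of_ge hc hs t ht'
    have e1 : u + (t + 1) * v = u + t * v + v := by ring
    have e2 : y - ((t + 1 : ℕ) : K) * x = y - (t : K) * x - x := by push_cast; ring
    refine ⟨fun hle => ?_, fun hlt => ?_⟩
    · -- `b` still in the long interval after `t` steps, and `x ≤ D - t x`: one more step moves it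
      have hle' : (t : K) * x ≤ D := by push_cast at hle; linarith
      have h2 := Sits.splitY_move hct (j := j) (IH1 hle') (by push_cast at hle; linarith)
      have e3 : D - ((t + 1 : ℕ) : K) * x = D - (t : K) * x - x := by push_cast; ring
      rw [e1, e2, e3]; exact h2
    · by_cases hle' : (t : K) * x ≤ D
      · -- the switch happens exactly at this step: `⌊D/x⌋ = t`
        have hfl : ⌊D / x⌋₊ = t := by
          rw [Nat.floor_eq_iff (div_nonneg hD0 hx.le)]
          constructor
          · rwa [le_div_iff₀ hx]
          · rw [div_lt_iff₀ hx]; push_cast at hlt ⊢; linarith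
        have h2 := Sits.splitY_keep (IH1 hle') (show D - (t : K) * x < x by push_cast at hlt; linarith)
        rw [hfl, e1, e2]; exact h2
      · -- already switched
        have h1 := IH2 (not_le.1 hle')
        have hDx : D - (⌊D / x⌋₊ : K) * x < x := by
          have h := h1.lt_len
          have hm : ⌊D / x⌋₊ < t := by
            rw [Nat.floor_lt (div_nonneg hD0 hx.le), div_lt_iff₀ hx]; exact not_le.1 hle'
          have hjv : j < v := by have := hs.lt; omega
          have hidx : u + ⌊D / x⌋₊ * v + j < u + t * v := by nlinarith
          rwa [if_pos hidx] at h
        have h2 := Sits.splitY_keep h1 hDx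
        rw [e1, e2]; exact h2

/-- **Property 2 (directed reduction), `h = x` side**: `b` in an interval of length `y` is not affected.
[cite: FortinGouicemGraillat2016, §3.2 Property 2] -/
theorem sits_splitX_iter_of_ge (hc : IsConfig a u v x y) (hs : Sits a b u v x y k₀ D) (hk : u ≤ k₀) :
    ∀ t : ℕ, (t : K) * y < x → Sits a b u (v + t * u) (x - t * y) y k₀ D
  | 0, _ => by simpa using hs
  | t + 1, ht => by
    have hy := hc.y_pos
    have ht' : (t : K) * y < x := by push_cast at ht; linarith
    have h := (sits_splitX_iter_of_ge hc hs hk t ht').splitX_of_ge hk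
    have e1 : v + (t + 1) * u = v + t * u + u := by ring
    have e2 : x - ((t + 1 : ℕ) : K) * y = x - (t : K) * y - y := by push_cast; ring
    rw [e1, e2]; exact h

/-- **Property 2 (directed reduction), `h = x` side**: the intervals of length `x` are cut FROM THE RIGHT
into pieces of length `y`. If `b` lies in the one with lower boundary `k₀ < u`, at distance `D`, then after
`t` steps (`t·y < x`): when `D < x - t·y`, `b` is still in the remaining left part (same lower boundary,
length `x - t·y`); otherwise `b` lies in one of the pieces of length `y`, at distance
`(D - (x - t·y)) mod y` from its lower boundary, which is one of the new points.
[cite: FortinGouicemGraillat2016, §3.2 Property 2, §4.2] -/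
theorem sits_splitX_iter_of_lt (hc : IsConfig a u v x y) (hs : Sits a b u v x y k₀ D) (hk : k₀ < u) :
    ∀ t : ℕ, (t : K) * y < x →
      (D < x - t * y → Sits a b u (v + t * u) (x - t * y) y k₀ D) ∧
      (x - t * y ≤ D → ∃ k₁ : ℕ, u ≤ k₁ ∧ Sits a b u (v + t * u) (x - t * y) y k₁ (fmod (D - (x - t * y)) y))
  | 0, _ => by
    refine ⟨fun _ => by simpa using hs, fun h => ?_⟩
    have h' := hs.lt_len
    rw [if_pos hk] at h'
    exact absurd h (by push_cast; linarith)
  | t + 1, ht => by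
    have hy := hc.y_pos
    have hD0 := hs.nonneg
    have ht' : (t : K) * y < x := by push_cast at ht; linarith
    have hct := splitX_iter hc t ht'
    have hyx : y < x - t * y := by push_cast at ht; linarith
    obtain ⟨IH1, IH2⟩ := sits_splitX_iter_of_lt hc hs hk t ht'
    have e1 : v + (t + 1) * u = v + t * u + u := by ring
    have e2 : x - ((t + 1 : ℕ) : K) * y = x - (t : K) * y - y := by push_cast; ring
    refine ⟨fun hlt => ?_, fun hle => ?_⟩
    · have h2 := Sits.splitX_keep (IH1 (by push_cast at hlt; linarith)) hk
        (show D < x - (t : K) * y - y by push_cast at hlt; linarith)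
      rw [e1, e2]; exact h2
    · by_cases hlt' : D < x - t * y
      · -- the switch happens exactly at this step
        have h2 := Sits.splitX_move hct hyx (IH1 hlt') hk
          (show x - (t : K) * y - y ≤ D by push_cast at hle; linarith)
        refine ⟨u + (v + t * u) + k₀, by omega, ?_⟩
        have hE0 : 0 ≤ D - (x - ((t + 1 : ℕ) : K) * y) := by push_cast at hle ⊢; linarith
        have hEy : D - (x - ((t + 1 : ℕ) : K) * y) < y := by push_cast; linarith
        rw [fmod_eq_self hE0 hEy, e1, e2]; exact h2
      · -- already switched: the distance is unchanged, the formula shifts by `y`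
        obtain ⟨k₁, hk₁, h1⟩ := IH2 (not_lt.1 hlt')
        refine ⟨k₁, hk₁, ?_⟩
        have h2 := Sits.splitX_of_ge h1 hk₁
        have hE0 : 0 ≤ D - (x - t * y) := by linarith [not_lt.1 hlt']
        have hshift : fmod (D - (x - ((t + 1 : ℕ) : K) * y)) y = fmod (D - (x - t * y)) y := by
          rw [show D - (x - ((t + 1 : ℕ) : K) * y) = (D - (x - t * y)) + y by push_cast; ring]
          exact fmod_add_self hE0 hy
        rw [hshift, e1, e2]; exact h2


/-- The form used by the algorithm on the `h = y` side: whenever `D < (t+1)·x` (always the case for the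
full quotient `t = ⌊y/x⌋`, since `D < y`), after the `t` steps `b` is at distance `D mod x` from the closest
point to its left. [cite: FortinGouicemGraillat2016, §4.2] -/
theorem sits_splitY_iter_fmod (hc : IsConfig a u v x y) {j : ℕ} (hs : Sits a b u v x y (u + j) D)
    (t : ℕ) (ht : (t : K) * x < y) (hD : D < ((t : K) + 1) * x) :
    ∃ k₁ : ℕ, Sits a b (u + t * v) v x (y - t * x) k₁ (fmod D x) := by
  have hx := hc.x_pos
  have hD0 := hs.nonneg
  obtain ⟨h1, h2⟩ := sits_splitY_iter_of_ge hc hs t ht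
  have hm : ⌊D / x⌋₊ ≤ t := by
    have h : ⌊D / x⌋₊ < t + 1 := by
      rw [Nat.floor_lt (div_nonneg hD0 hx.le), div_lt_iff₀ hx]; push_cast; exact hD
    omega
  rcases lt_or_ge D ((t : K) * x) with hlt | hle
  · exact ⟨_, h2 hlt⟩
  · have hm' : t ≤ ⌊D / x⌋₊ := by rw [Nat.le_floor_iff (div_nonneg hD0 hx.le), le_div_iff₀ hx]; exact hle
    have hmt : ⌊D / x⌋₊ = t := le_antisymm hm hm'
    refine ⟨u + t * v + j, ?_⟩
    rw [fmod_def, hmt]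
    exact h1 hle

end Iter

/-! ### §4.2 — the regular lower-bound test, transcribed -/

/-- The variables of the algorithm [FortinGouicemGraillat2016, §4.2]: the two lengths `p`, `q` (Lefèvre's
`x`, `y`), the running lower bound `d` on the distance from `{b}` to the closest point `{k·a}` to its left,
and the counters `u`, `v`. [cite: FortinGouicemGraillat2016, §4.2 Algorithm 2] -/
structure RState (K : Type*) where
  /-- length of the intervals whose lower boundaries have the small indices (Lefèvre's `x`) -/
  p : K
  /-- the other length (Lefèvre's `y`) -/
  q : K
  /-- running lower bound on `min {b - k·a}` over the points placed so far -/
  d : K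
  /-- counter updated by `u = u + k*v` -/
  u : ℕ
  /-- counter updated by `v = v + k*u` -/
  v : ℕ

/-- One round of the `while True` loop, verbatim:
`if p < q then { k = ⌊q/p⌋; q = q - k*p; u = u + k*v; d = d mod p }`
`else { k = ⌊p/q⌋; p = p - k*q; v = v + k*u; if d ≥ p then d = (d - p) mod q }`.
[cite: FortinGouicemGraillat2016, §4.2 Algorithm 2, lines 4–12] -/
def rstep (s : RState K) : RState K :=
  if s.p < s.q then
    ⟨s.p, s.q - (⌊s.q / s.p⌋₊ : K) * s.p, fmod s.d s.p, s.u + ⌊s.q / s.p⌋₊ * s.v, s.v⟩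
  else
    ⟨s.p - (⌊s.p / s.q⌋₊ : K) * s.q, s.q,
      if s.p - (⌊s.p / s.q⌋₊ : K) * s.q ≤ s.d then fmod (s.d - (s.p - (⌊s.p / s.q⌋₊ : K) * s.q)) s.q
      else s.d,
      s.u, s.v + ⌊s.p / s.q⌋₊ * s.u⟩

/-- The end of the loop body on the updated variables `s'`: `if u + v ≥ N then return (d > ε'')`, else go
round again (`cont`). DEVIATION (see the module doc): if a length has become `0` we return Failure.
[cite: FortinGouicemGraillat2016, §4.2 Algorithm 2, line 13] -/
def rexit (ε : K) (N : ℕ) (cont : RState K → Bool) (s' : RState K) : Bool :=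
  if s'.p = 0 ∨ s'.q = 0 then false
  else if N ≤ s'.u + s'.v then decide (ε < s'.d)
  else cont s'

/-- The `while True` loop with an iteration bound (first argument; exhausting it answers Failure).
[cite: FortinGouicemGraillat2016, §4.2 Algorithm 2] -/
def rloop (ε : K) (N : ℕ) : ℕ → RState K → Bool
  | 0, _ => false
  | fuel + 1, s => rexit ε N (rloop ε N fuel) (rstep s)

/-- The printed initialisation `p ← {a}; q ← 1; d ← {b}; u ← 1; v ← 0` (the "virtual configuration with
one point" of [Lefevre2005, Fig. 2]). [cite: FortinGouicemGraillat2016, §4.2 Algorithm 2, lines 1–2] -/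
def rinit (a b : K) : RState K := ⟨Int.fract a, 1, Int.fract b, 1, 0⟩

/-- **The regular lower-bound test** of [FortinGouicemGraillat2016, §4.2] for the segment `b - a·x`,
threshold `ε` and `N` points: `if {b} < ε'' then Failure` else run the loop from the printed
initialisation (iteration bound `N`). `true` = Success. [cite: FortinGouicemGraillat2016, §4.2 Algorithm 2] -/
def regularTest (a b ε : K) (N : ℕ) : Bool :=
  if Int.fract b < ε then false else rloop ε N N (rinit a b)

/-! ### Invariant and soundness -/

section Spec

variable {a b ε : K} {N : ℕ}

/-- Loop invariant at the end of an iteration (on the updated variables): the lengths form a two-length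
configuration `IsConfig a U V p q` whose true interval counts `U`, `V` dominate the counters `u`, `v`;
`b` sits at distance `D` from the closest point to its left; and `d = D`, except right after the `else`
branch when `b` lies in an interval of length `q` and `d ≥ p`, where the listing has already subtracted the
new `p` ("which is similar to considering the configuration (i+1, 1) … this would have been done in the next
loop iteration", [FortinGouicemGraillat2016, §4.2]) and `d = D - p`.
[cite: FortinGouicemGraillat2016, §4.2] -/
def RInv (a b : K) (s : RState K) : Prop :=
  ∃ U V k₀ : ℕ, ∃ D : K, s.u ≤ U ∧ s.v ≤ V ∧ IsConfig a U V s.p s.q ∧ Sits a b U V s.p s.q k₀ D ∧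
    (s.d = D ∨ (s.p < s.q ∧ U ≤ k₀ ∧ s.p ≤ D ∧ s.d = D - s.p))

/-- At exit (`u + v ≥ N` and `d > ε''`) the answer is right: `d ≤ D ≤ {b - k·a}` for all the `U + V ≥ N`
points placed. [cite: FortinGouicemGraillat2016, §4.2] -/
theorem RInv.sound {s : RState K} (h : RInv a b s) (hN : N ≤ s.u + s.v) (hε : ε < s.d) :
    ∀ k : ℕ, k < N → ε < Int.fract (b - k * a) := by
  obtain ⟨U, V, k₀, D, hu, hv, hc, hs, hd⟩ := h
  intro k hk
  have hD := hs.le_fract hc (k := k) (by omega)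
  have hdD : s.d ≤ D := by
    rcases hd with h | ⟨_, _, _, h⟩
    · exact h.le
    · rw [h]; linarith [hc.x_pos]
  linarith

/-- **One iteration preserves the invariant** (as long as no length vanishes). `p < q`: `k = ⌊q/p⌋` steps of
the `h = y` transition at once, `d mod p` is the new distance (Property 2, cut from the left; an anticipated
`d = D - p` gives the same `mod`). `q ≤ p`: `k = ⌊p/q⌋` steps of the `h = x` transition, the intervals of
length `p` are cut from the right, whence `(d - p) mod q`; if `b` lies in an interval of length `q` the
update anticipates the next iteration. [cite: FortinGouicemGraillat2016, §4.2] -/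
theorem RInv.step {s : RState K} (h : RInv a b s) (hp : (rstep s).p ≠ 0) (hq : (rstep s).q ≠ 0) :
    RInv a b (rstep s) := by
  obtain ⟨U, V, k₀, D, hu, hv, hc, hs, hd⟩ := h
  have hx := hc.x_pos
  have hy := hc.y_pos
  have hD0 := hs.nonneg
  by_cases hlt : s.p < s.q
  · -- branch `p < q`
    have e : rstep s = ⟨s.p, s.q - (⌊s.q / s.p⌋₊ : K) * s.p, fmod s.d s.p, s.u + ⌊s.q / s.p⌋₊ * s.v, s.v⟩ := by
      simp [rstep, hlt]
    rw [e] at hq ⊢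
    set k := ⌊s.q / s.p⌋₊ with hk_def
    have hkle : (k : K) * s.p ≤ s.q := by
      have h := Nat.floor_le (div_nonneg hy.le hx.le); rw [← hk_def] at h
      rwa [le_div_iff₀ hx] at h
    have hk : (k : K) * s.p < s.q := lt_of_le_of_ne hkle (fun h => hq (by simp only; rw [h, sub_self]))
    have hq1 : s.q < ((k : K) + 1) * s.p := by
      have h := Nat.lt_floor_add_one (s.q / s.p); rw [← hk_def] at h
      rwa [div_lt_iff₀ hx] at h
    have hc' := splitY_iter hc k hk
    refine ⟨U + k * V, V, ?_⟩
    by_cases hk₀ : k₀ < U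
    · -- `b` in an interval of length `p`: untouched, and `d = D < p` so `d mod p = d`
      have hs' := sits_splitY_iter_of_lt hc hs hk₀ k hk
      have hDp : D < s.p := by have h := hs.lt_len; rwa [if_pos hk₀] at h
      have hdD : s.d = D := by
        rcases hd with h | ⟨_, h, _⟩
        · exact h
        · exact absurd hk₀ (not_lt.2 h)
      refine ⟨k₀, D, by simp only; gcongr, hv, hc', hs', Or.inl ?_⟩
      simp only; rw [hdD, fmod_eq_self hD0 hDp]
    · -- `b` in an interval of length `q`: cut from the left, new distance `D mod p`
      obtain ⟨j, rfl⟩ := Nat.exists_eq_add_of_le (not_lt.1 hk₀)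
      have hDq : D < s.q := by have h := hs.lt_len; rwa [if_neg hk₀] at h
      obtain ⟨k₁, hs'⟩ := sits_splitY_iter_fmod hc hs k hk (by linarith)
      refine ⟨k₁, fmod D s.p, by simp only; gcongr, hv, hc', hs', Or.inl ?_⟩
      simp only
      rcases hd with h | ⟨_, _, hpD, h⟩
      · rw [h]
      · rw [h, fmod_sub_self hpD hx]
  · -- branch `q ≤ p`
    have e : rstep s = ⟨s.p - (⌊s.p / s.q⌋₊ : K) * s.q, s.q,
        if s.p - (⌊s.p / s.q⌋₊ : K) * s.q ≤ s.d then fmod (s.d - (s.p - (⌊s.p / s.q⌋₊ : K) * s.q)) s.q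
        else s.d, s.u, s.v + ⌊s.p / s.q⌋₊ * s.u⟩ := by
      simp [rstep, hlt]
    rw [e] at hp ⊢
    set k := ⌊s.p / s.q⌋₊ with hk_def
    have hkle : (k : K) * s.q ≤ s.p := by
      have h := Nat.floor_le (div_nonneg hx.le hy.le); rw [← hk_def] at h
      rwa [le_div_iff₀ hy] at h
    have hk : (k : K) * s.q < s.p := lt_of_le_of_ne hkle (fun h => hp (by simp only; rw [h, sub_self]))
    have hp1 : s.p < ((k : K) + 1) * s.q := by
      have h := Nat.lt_floor_add_one (s.p / s.q); rw [← hk_def] at h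
      rwa [div_lt_iff₀ hy] at h
    have hc' := splitX_iter hc k hk
    have hdD : s.d = D := by
      rcases hd with h | ⟨h, _⟩
      · exact h
      · exact absurd h hlt
    refine ⟨U, V + k * U, ?_⟩
    by_cases hk₀ : k₀ < U
    · -- `b` in an interval of length `p`: cut from the right
      obtain ⟨h1, h2⟩ := sits_splitX_iter_of_lt hc hs hk₀ k hk
      by_cases hDp : D < s.p - k * s.q
      · refine ⟨k₀, D, hu, by simp only; nlinarith, hc', h1 hDp, Or.inl ?_⟩
        simp only; rw [hdD, if_neg (not_le.2 hDp)]
      · obtain ⟨k₁, _, hs'⟩ := h2 (not_lt.1 hDp)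
        refine ⟨k₁, _, hu, by simp only; nlinarith, hc', hs', Or.inl ?_⟩
        simp only; rw [hdD, if_pos (not_lt.1 hDp)]
    · -- `b` in an interval of length `q`: untouched; the update may anticipate the next iteration
      have hs' := sits_splitX_iter_of_ge hc hs (not_lt.1 hk₀) k hk
      have hDq : D < s.q := by have h := hs.lt_len; rwa [if_neg hk₀] at h
      refine ⟨k₀, D, hu, by simp only; nlinarith, hc', hs', ?_⟩
      simp only
      by_cases hpD : s.p - k * s.q ≤ D
      · right
        refine ⟨by linarith, not_lt.1 hk₀, hpD, ?_⟩
        rw [hdD, if_pos hpD, fmod_eq_self (sub_nonneg.2 hpD) (by linarith)]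
      · left; rw [hdD, if_neg hpD]

/-- **The loop is a correct filter** from any state satisfying the invariant.
[cite: FortinGouicemGraillat2016, §4.2] -/
theorem rloop_sound : ∀ (fuel : ℕ) (s : RState K), RInv a b s → rloop ε N fuel s = true →
    ∀ k : ℕ, k < N → ε < Int.fract (b - k * a)
  | 0, _, _, h => by simp [rloop] at h
  | fuel + 1, s, hs, h => by
    rw [rloop, rexit] at h
    split_ifs at h with hz hN
    · have hp : (rstep s).p ≠ 0 := fun e => hz (Or.inl e)
      have hq : (rstep s).q ≠ 0 := fun e => hz (Or.inr e)
      exact (hs.step hp hq).sound hN (of_decide_eq_true h)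
    · have hp : (rstep s).p ≠ 0 := fun e => hz (Or.inl e)
      have hq : (rstep s).q ≠ 0 := fun e => hz (Or.inr e)
      exact rloop_sound fuel (rstep s) (hs.step hp hq) h

/-- `{b - a} = {b} - {a}` when `{a} ≤ {b}`. [folklore] -/
private theorem fract_sub_of_le' {p q : K} (h : Int.fract q ≤ Int.fract p) :
    Int.fract (p - q) = Int.fract p - Int.fract q := by
  rw [Int.fract_eq_iff]
  refine ⟨sub_nonneg.2 h, by linarith [Int.fract_lt_one p, Int.fract_nonneg q], ⌊p⌋ - ⌊q⌋, ?_⟩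
  rw [Int.cast_sub, ← Int.self_sub_fract p, ← Int.self_sub_fract q]; ring

/-- **The first iteration** from the printed initialisation lands in the invariant: it places the points
`0, a, …, k₁·a` (`k₁ = ⌊1/{a}⌋`), i.e. Lefèvre's initial configuration followed by `k₁ - 1` steps `h = y`,
and `d = {b} mod {a}`; the printed counters `(u, v) = (1, 0)` are dominated by the true `(k₁, 1)`.
[cite: FortinGouicemGraillat2016, §4.2] -/
theorem rinv_rstep_rinit (a b : K) (hp : (rstep (rinit a b)).p ≠ 0) (hq : (rstep (rinit a b)).q ≠ 0) :
    RInv a b (rstep (rinit a b)) := by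
  have ha1 : Int.fract a < 1 := Int.fract_lt_one a
  have e : rstep (rinit a b) = ⟨Int.fract a, 1 - (⌊1 / Int.fract a⌋₊ : K) * Int.fract a,
      fmod (Int.fract b) (Int.fract a), 1 + ⌊1 / Int.fract a⌋₊ * 0, 0⟩ := by
    simp [rstep, rinit, ha1]
  rw [e] at hp hq ⊢
  simp only at hp hq
  have ha : Int.fract a ≠ 0 := hp
  have hx : 0 < Int.fract a := lt_of_le_of_ne (Int.fract_nonneg a) (Ne.symm ha)
  have hc0 := IsConfig.init a ha
  -- `k₁ = t + 1 ≥ 1`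
  obtain ⟨t, ht⟩ : ∃ t : ℕ, ⌊1 / Int.fract a⌋₊ = t + 1 :=
    Nat.exists_eq_add_one_of_ne_zero (by
      rw [← Nat.pos_iff_ne_zero, Nat.floor_pos, le_div_iff₀ hx]; linarith)
  have hkle : ((t : K) + 1) * Int.fract a ≤ 1 := by
    have h := Nat.floor_le (show (0 : K) ≤ 1 / Int.fract a by positivity)
    rw [ht, le_div_iff₀ hx] at h; push_cast at h; exact h
  have hklt : ((t : K) + 1) * Int.fract a < 1 := by
    refine lt_of_le_of_ne hkle fun h => hq ?_
    rw [ht]; push_cast; rw [h, sub_self]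
  have hk2 : 1 < ((t : K) + 1 + 1) * Int.fract a := by
    have h := Nat.lt_floor_add_one (1 / Int.fract a)
    rw [ht, div_lt_iff₀ hx] at h; push_cast at h; exact h
  have htt : (t : K) * Int.fract a < 1 - Int.fract a := by linarith
  have hc1 := splitY_iter hc0 t htt
  rw [ht]
  have e1 : 1 - ((t + 1 : ℕ) : K) * Int.fract a = 1 - Int.fract a - t * Int.fract a := by push_cast; ring
  rw [e1]
  refine ⟨1 + t * 1, 1, ?_⟩
  by_cases hb : Int.fract b < Int.fract a
  · -- `b` in `[0, {a})`: index 0, distance `{b}`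
    have hs0 : Sits a b 1 1 (Int.fract a) (1 - Int.fract a) 0 (Int.fract b) :=
      ⟨by norm_num, by simp, by simp [hb]⟩
    have hs1 := sits_splitY_iter_of_lt hc0 hs0 Nat.one_pos t htt
    refine ⟨0, Int.fract b, by simp, zero_le_one, hc1, hs1, Or.inl ?_⟩
    simp only; exact fmod_eq_self (Int.fract_nonneg b) hb
  · -- `b` in `[{a}, 1)`: index 1, distance `{b} - {a}`
    have hs0 : Sits a b 1 1 (Int.fract a) (1 - Int.fract a) (1 + 0) (Int.fract b - Int.fract a) :=
      ⟨by norm_num, by simpa using fract_sub_of_le' (not_lt.1 hb), by simp [Int.fract_lt_one b]⟩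
    obtain ⟨k₁, hs1⟩ := sits_splitY_iter_fmod hc0 hs0 t htt (by linarith [Int.fract_lt_one b])
    refine ⟨k₁, _, by simp, zero_le_one, hc1, hs1, Or.inl ?_⟩
    simp only; rw [fmod_sub_self (not_lt.1 hb) hx]

/-- **Theorem (the regular HR-case test is a correct filter).** If `regularTest a b ε N` answers Success
then every `k < N` has `ε < {b - k·a}`: no point of the grid is within `ε` of the segment on the
sub-domain ("computes a lower bound on `{b - a·x mod 1 | x < N}`"). No hypothesis on `a`, `b`, `ε`, `N`.
[cite: FortinGouicemGraillat2016, §4.2 Algorithm 2] -/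
theorem regularTest_sound {a b ε : K} {N : ℕ} (h : regularTest a b ε N = true) :
    ∀ k : ℕ, k < N → ε < Int.fract (b - k * a) := by
  unfold regularTest at h
  split_ifs at h with hb
  cases N with
  | zero => intro k hk; exact absurd hk (Nat.not_lt_zero _)
  | succ n =>
    rw [rloop, rexit] at h
    split_ifs at h with hz hN
    · have hp : (rstep (rinit a b)).p ≠ 0 := fun e => hz (Or.inl e)
      have hq : (rstep (rinit a b)).q ≠ 0 := fun e => hz (Or.inr e)
      exact (rinv_rstep_rinit a b hp hq).sound hN (of_decide_eq_true h)
    · have hp : (rstep (rinit a b)).p ≠ 0 := fun e => hz (Or.inl e)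
      have hq : (rstep (rinit a b)).q ≠ 0 := fun e => hz (Or.inr e)
      exact rloop_sound n _ (rinv_rstep_rinit a b hp hq) h

/-- **Bridge to Lefèvre's Algorithm 1**: a successful regular test yields the hypothesis
`N ≤ algorithm1 a b ε N` of `Lefevre2005.le_algorithm1_iff` and of the sub-domain certificates of
`Literature.ComputerArithmetic.Lefevre2005.SubdomainCertificate`, without evaluating Algorithm 1.
[cite: FortinGouicemGraillat2016, §4.1–4.2] -/
theorem le_algorithm1_of_regularTest {a b ε : K} {N : ℕ} (h : regularTest a b ε N = true) :
    N ≤ algorithm1 a b ε N :=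
  (le_algorithm1_iff a b ε N).2 fun k hk => (regularTest_sound h k hk).le

/-- The no-point statement directly. [cite: FortinGouicemGraillat2016, §4.2] -/
theorem forall_le_fract_of_regularTest {a b ε : K} {N : ℕ} (h : regularTest a b ε N = true) :
    ∀ k : ℕ, k < N → ε ≤ Int.fract (b - k * a) :=
  fun k hk => (regularTest_sound h k hk).le

end Spec

/-! ### Evaluation (the algorithm computes in `ℚ`; the kernel runs it) -/

/-- The sub-domain of `Lefevre2005.SegmentGrid`'s closing example (`2^16` arguments, 64-bit slope and
intercept, window `2^-31`): the regular test succeeds — here every partial quotient of the slope is `1`, the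
loop runs through some two dozen division configurations. [cite: FortinGouicemGraillat2016, §4.2] -/
example : regularTest (0x9E3779B97F4A7C15 / 2 ^ 64 : ℚ) (0x243F6A8885A308D3 / 2 ^ 64 + 1 / 2 ^ 31)
    (2 * (1 / 2 ^ 31)) (2 ^ 16) = true := by
  decide +kernel

/-- … hence, through `le_algorithm1_of_regularTest` and `Lefevre2005.le_abs_sub_int_of_algorithm1_self`, the
same real-number statement as there, without running the subtractive algorithm.
[cite: FortinGouicemGraillat2016, §4.2] -/
example : ∀ k : ℕ, k < 2 ^ 16 → ∀ m : ℤ,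
    (((1 / 2 ^ 31 : ℚ)) : ℝ) ≤ |(((0x243F6A8885A308D3 / 2 ^ 64 : ℚ)) : ℝ)
      - k * (((0x9E3779B97F4A7C15 / 2 ^ 64 : ℚ)) : ℝ) - m| := by
  have h : 2 ^ 16 ≤ algorithm1 (((0x9E3779B97F4A7C15 / 2 ^ 64 : ℚ)) : ℝ)
      ((((0x243F6A8885A308D3 / 2 ^ 64 + 1 / 2 ^ 31 : ℚ)) : ℝ))
      (((2 * (1 / 2 ^ 31) : ℚ)) : ℝ) (2 ^ 16) :=
    (le_algorithm1_ratCast_iff _ _ _ _).2 (le_algorithm1_of_regularTest (by decide +kernel))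
  rw [Rat.cast_add, Rat.cast_mul, Rat.cast_ofNat] at h
  exact le_abs_sub_int_of_algorithm1_self h

/-- A slope with a large partial quotient (`{a} = 4/5 + 2^-40`: continued fraction `[0; 1, 4, k₃, …]` with
`k₃ = ⌊2^40/25 - 1/5⌋ ≈ 4.4·10^10`): Lefèvre's subtractive Algorithm 1 needs 13 110 rounds of its loop to
report that none of the `N = 2^16` points is within `2^-20` of `b = 1/3` (they all lie within `2^-22` of a
multiple of `1/5`); the regular test answers after THREE divisions — but it answers Failure, because the
third division configuration already holds about `2.2·10^11` points, some of which are within the window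
(the caveat of the module doc: a correct filter, not an exact test). [cite: FortinGouicemGraillat2016, §4.1–4.2] -/
example : regularTest (4 / 5 + 1 / 2 ^ 40 : ℚ) (1 / 3) (1 / 2 ^ 20) (2 ^ 16) = false := by
  decide +kernel

end Literature.ComputerArithmetic.FortinGouicemGraillat2016
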